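import Literature.MathematicalPhysics.QuantumFieldTheory.Balaban1983to89.B12Eq419Kernel
import Literature.MathematicalPhysics.QuantumFieldTheory.Balaban1983to89.B12Eq45LocalisedBlocks
import Literature.MathematicalPhysics.QuantumFieldTheory.Balaban1983to89.B12Sect4Statements

/-!
# Bałaban, *Renormalization group approach to lattice gauge field theories. I* (CMP 109, 1987) [Balaban1987RG1], p. 286 «More
# generally»: the decay of the kernels `𝐄⁽ⁿ⁾(X, x₁,…,x_n)` of (4.19) in the position of their points — a bound for the ACTUAL kernel
# `kernelE n (𝐄 ∘ 𝐇) 0` from the (4.4)/(1.18)/Prop. 9/(190)-shape inputs, and the printed tree-decay shape under a geometric comparison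

HONEST FRAMING (cell `lit-balaban`, verbatim): statement-level skeleton of published theorems with citation tags; proofs where landed;
nothing here is a claim about the Yang–Mills mass gap.

PDF held: `paper:balaban1987-cmp109-rg-i-small-field` (journal page = PDF page + 248); p. 286 [PDF 38] re-read by this seat in the held text
layer.  THE PRINT, p. 286: *«… we apply the identities (4.3) with localizations at the points x, x₃ fixed, i.e. with the summations over
x, x₃ left undone. A term corresponding to such a partition can be estimated by Σ_{x,x₃}(8B₃α₂⁻¹)⁴E₀exp(−κd_j(X) − δ₀dist^{(ξ)}(X,x) −
δ₀dist^{(ξ)}(X,x₃)) … More generally, let us notice that by a similar argument we can bound the derivative 𝐄⁽ⁿ⁾(X, x₁,…,x_n) by a constant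
times the exponential exp(−O(1)κd_j(X∪{x₁,…,x_n})), where d_j(X∪{x₁,…,x_n}) is a length of a shortest tree graph connecting cubes □
building the domain X, and points x₁,…,x_n. This bound is enough to prove bounds of the type (4.22), although with a worse constant.»*

WHAT IS REPRODUCED (SKELETON row **B12.Txt@286b**, owners r09 (display) / r20 (fold; typed shape `B12Sect4Statements.TreeDecayRemark286Printed
En djXpts κ c a` with the unprinted «constant» `c` and «O(1)» rate `a` explicit, head `typed p239748`).  With the kernel dictionary of
`B12Eq419Kernel` (p05 gen 9: `kernelE n f b₀ xs = Dⁿf(b₀)[δ_{xs₁}·,…,δ_{xs_n}·]`) the printed object `𝐄⁽ⁿ⁾(X, x₁,…,x_n)` IS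
`kernelE n (𝐄 ∘ 𝐇) 0 xs` for the (4.2)–(4.3) composite `B ↦ E^{(j)}(X, exp iξ𝐇_j(□₀,B))`, and «the similar argument» = (4.3) with the
localizations at the points fixed = gen 8's `B12Eq45LocalisedBlocks.norm_iteratedFDeriv_comp_le_of_loc` with the point insertions as arguments.
* §1 **`norm_kernelE_comp_le_of_loc`** — for EVERY point `x_k` of the tuple: `‖𝐄⁽ⁿ⁾(xs)[b₁,…,b_n]‖ ≤ Cₙ · S · w(x_k) · Π‖b_i‖`, where
  `S` = the sup of the outer map on the (4.4)-ball ((1.18): `E₀e^{−κd_j(X)}`), `w(x) ≤ 1` the FIRST-ORDER localisation weight of a field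
  localized at the point `x` (the (190)-shape bound `‖D𝐇(y)[δ_x c]‖ ≤ w(x)K|c|` on the analyticity ball; print: `w(x) = exp(−δ₀dist^{(ξ)}(X,x))`),
  `Cₙ = (2n²B₃/α₂)ⁿ`, `B₃ = max{S_H,K}·max{1,2n/a}ⁿ` — inputs exactly those of (4.5) (`B12Eq45LocalisedBlocks`); **`opNorm_kernelE_comp_le_of_loc`**
  (the same for the operator norm of the `n`-linear kernel value), `opNorm_kernelE_comp_le_exp` (print's weights `e^{−κd_j(X)}`, `e^{−δ₀dist(X,x_k)}`
  combined: `≤ CₙE₀ exp(−κd_j(X) − δ₀dist^{(ξ)}(X,x_k))` for every `k` — decay in the FARTHEST point).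
* §2 **`treeDecayRemark286_of_loc`** — r20's typed shape `TreeDecayRemark286Printed (fun xs => 𝐄⁽ⁿ⁾(xs)) djXpts κ (CₙE₀) a′` for the actual
  kernel, from §1 and ONE explicit GEOMETRIC COMPARISON hypothesis `hgeom : ∀ xs, ∃ k, a′κ·d_j(X∪{x₁…x_n}) ≤ κd_j(X) + δ₀dist^{(ξ)}(X,x_k)`
  (the tree length of `X ∪ {points}` against `d_j(X)` plus the distance of the farthest point, with the «O(1)» rate `a′`).
* §3 (v1.1, same unit and generation, APPEND-ONLY) **`treeDecayRemark286_of_subadditive`** — `hgeom` DISCHARGED for every tree length with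
  the concatenation property of a shortest tree graph *"connecting cubes □ building the domain X, and points x₁, …, x_n"*:
  `d_j(X∪{x₁,…,x_n}) ≤ d_j(X) + Σ_k dist^{(ξ)}(X, x_k)` (prolong a shortest tree of `X` by the `n` segments to the points) — then the printed
  bound holds with the EXPLICIT rate `a′ = min{1, δ₀/(nκ)}` (the «O(1)») and constant `CₙE₀`, for `n ≥ 1`, `κ > 0`, `d_j(X) ≥ 0`
  (`sum_le_card_mul_max`: `Σ_k dist(X,x_k) ≤ n·max_k dist(X,x_k)`, the farthest point).
HONEST SCOPE.  (a) Print's own route is the tree-graph decay of [15] Sect. G for several localized arguments in one block (cell GAPS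
G-B11-G2a; it gives decay in the length of a tree through ALL the points); ours uses the FIRST-ORDER (190)-shape bounds only and therefore
decays in the farthest point of the tuple (`max_k dist ≥ (1/n)Σ_k dist` is how this still yields the printed shape «with a worse constant»,
absorbed in `a′`).  (b) `hgeom` is an INPUT: the cell keeps `d_j` abstract (`LocDomainSys.dj`, DIVERGENCE F5) and print does not display the
comparison; it is NOT asserted here — v1.1 §3 derives it, with `a′ = min{1, δ₀/(nκ)}`, from the subadditivity `d_j(X∪{x_i}) ≤ d_j(X) +
Σ_i dist(X,x_i)` alone (a property of any shortest-tree length; the cell's concrete tree lengths are not instantiated here).  (c) `E₀`, `κ`, `δ₀`, `dist^{(ξ)}` enter only through the hypotheses `hS`/`hloc` in their printed shapes.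
(d) Nothing of (4.22) or of the right member of the p. 286 display (rows B12.Eq4.21-4.22 / B12.Disp@286, r20 `B12Term286DifferentBlocks`,
p07) is touched.  Mega-formalization `lit-balaban`, HOME `run/shared/lean/pub/lit-balaban/`, Phase-2 proof seat p05 gen 9 (unit
`lit-balaban-p05`, free-target protocol G.5-34(d)).  Imports `…B12Eq419Kernel` (p05 g9), `…B12Eq45LocalisedBlocks` (p05 g8),
`…B12Sect4Statements` (r20) BY NAME; modifies nothing there; theorems only.
-/

noncomputable section

open Set Metric Finset
open scoped BigOperators

namespace Literature.MathematicalPhysics.QuantumFieldTheory.Balaban1983to89.B12KernelDecay286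

open Literature.MathematicalPhysics.QuantumFieldTheory.Balaban1983to89
open B12Eq419Kernel B12Eq45LocalisedBlocks B12Sect4Statements

variable {ι : Type*} [Fintype ι] [DecidableEq ι] {𝔸 : Type*} [NormedAddCommGroup 𝔸] [NormedSpace ℂ 𝔸]
  {E : Type*} [NormedAddCommGroup E] [NormedSpace ℂ E] [CompleteSpace E]
  {F : Type*} [NormedAddCommGroup F] [NormedSpace ℂ F] [CompleteSpace F]

/-! ## §1. The kernel `𝐄⁽ⁿ⁾(X, x₁,…,x_n)` of `𝐄 ∘ 𝐇` is small when ONE of its points is far from `X` -/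

/-- **p. 286 «by a similar argument we can bound the derivative 𝐄⁽ⁿ⁾(X, x₁,…,x_n)»** — (4.3) with the localizations at the points
fixed: for the composite `f ∘ H` (`f` = the (4.4) outer map, analytic on an open `U ⊇ ball 0 α₂` of the configuration space `E` with
`‖f‖ ≤ S` there; `H` = `𝐇_j(□₀,·)`, analytic on an open `UW ⊇ ball 0 a` of the `B`-fields `ι → 𝔸` with `‖H‖ ≤ S_H` there and `H 0 = 0`)
and first-order localisation weights `w(x) ∈ [0,1]` of the points (`‖DH(y)[δ_x c]‖ ≤ w(x)·K·|c|` on the ball — the (190)-shape bound for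
a field localized at `x`; print `w(x) = exp(−δ₀dist^{(ξ)}(X,x))`), the kernel of `Dⁿ(f ∘ H)(0)` at the points `xs` obeys, for EVERY `k`,
`‖𝐄⁽ⁿ⁾(xs)[b]‖ ≤ (2n²B₃/α₂)ⁿ · S · w(xs k) · Π_i ‖b_i‖`, `B₃ = max{S_H,K}·max{1,2n/a}ⁿ` (gen 8's `norm_iteratedFDeriv_comp_le_of_loc` with
the arguments `δ_{xs_i} b_i` and the localized one `:= k`). [cite: Balaban1987RG1, p.286; (4.3)–(4.5) pp.281–282] -/
theorem norm_kernelE_comp_le_of_loc {U : Set E} (hU : IsOpen U) {α₂ S : ℝ} (hα : 0 < α₂)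
    (hballE : ball (0 : E) α₂ ⊆ U) {f : E → F} (hf : AnalyticOnNhd ℂ f U) (hS : ∀ y ∈ ball (0 : E) α₂, ‖f y‖ ≤ S)
    {UW : Set (ι → 𝔸)} (hUW : IsOpen UW) {a SH : ℝ} (ha : 0 < a) (hball : ball (0 : ι → 𝔸) a ⊆ UW)
    {H : (ι → 𝔸) → E} (hH : AnalyticOnNhd ℂ H UW) (hSH : ∀ y ∈ ball (0 : ι → 𝔸) a, ‖H y‖ ≤ SH) (hH0 : H 0 = 0)
    {K : ℝ} (hK : 0 ≤ K) (w : ι → ℝ) (hw0 : ∀ x, 0 ≤ w x) (hw1 : ∀ x, w x ≤ 1)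
    (hloc : ∀ x, ∀ y ∈ ball (0 : ι → 𝔸) a, ∀ c : 𝔸, ‖fderiv ℂ H y (Pi.single x c)‖ ≤ w x * (K * ‖c‖))
    {n : ℕ} (hB : α₂ ≤ 2 * (max SH K * (max 1 (2 * (n : ℝ) / a)) ^ n)) (xs : Fin n → ι) (k : Fin n) (b : Fin n → 𝔸) :
    ‖kernelE (𝕜 := ℂ) n (f ∘ H) 0 xs b‖ ≤
      (2 * (n : ℝ) ^ 2 * (max SH K * (max 1 (2 * (n : ℝ) / a)) ^ n) / α₂) ^ n * S * w (xs k) * ∏ i, ‖b i‖ := by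
  rw [kernelE_apply]
  have h := norm_iteratedFDeriv_comp_le_of_loc hU hα hballE hf hS hUW ha hball hH hSH hH0
    (fun i => Pi.single (xs i) (b i)) (hw0 (xs k)) (hw1 (xs k)) hK (fun i => i = k) k rfl
    (fun i hi y hy => by
      subst hi
      simpa only [Pi.norm_single] using hloc (xs i) y hy (b i)) hB
  simpa only [Pi.norm_single] using h

/-- The same for the OPERATOR NORM of the kernel value `𝐄⁽ⁿ⁾(xs) ∈ L(𝔸,…,𝔸; F)` (print's «bound the derivative 𝐄⁽ⁿ⁾(X, x₁,…,x_n)»):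
`‖𝐄⁽ⁿ⁾(xs)‖ ≤ (2n²B₃/α₂)ⁿ · S · w(xs k)` for every `k` (`0 ≤ S`). [cite: Balaban1987RG1, p.286; (4.5) p.282] -/
theorem opNorm_kernelE_comp_le_of_loc {U : Set E} (hU : IsOpen U) {α₂ S : ℝ} (hα : 0 < α₂) (hS0 : 0 ≤ S)
    (hballE : ball (0 : E) α₂ ⊆ U) {f : E → F} (hf : AnalyticOnNhd ℂ f U) (hS : ∀ y ∈ ball (0 : E) α₂, ‖f y‖ ≤ S)
    {UW : Set (ι → 𝔸)} (hUW : IsOpen UW) {a SH : ℝ} (ha : 0 < a) (hball : ball (0 : ι → 𝔸) a ⊆ UW)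
    {H : (ι → 𝔸) → E} (hH : AnalyticOnNhd ℂ H UW) (hSH : ∀ y ∈ ball (0 : ι → 𝔸) a, ‖H y‖ ≤ SH) (hH0 : H 0 = 0)
    {K : ℝ} (hK : 0 ≤ K) (w : ι → ℝ) (hw0 : ∀ x, 0 ≤ w x) (hw1 : ∀ x, w x ≤ 1)
    (hloc : ∀ x, ∀ y ∈ ball (0 : ι → 𝔸) a, ∀ c : 𝔸, ‖fderiv ℂ H y (Pi.single x c)‖ ≤ w x * (K * ‖c‖))
    {n : ℕ} (hB : α₂ ≤ 2 * (max SH K * (max 1 (2 * (n : ℝ) / a)) ^ n)) (xs : Fin n → ι) (k : Fin n) :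
    ‖kernelE (𝕜 := ℂ) n (f ∘ H) 0 xs‖ ≤
      (2 * (n : ℝ) ^ 2 * (max SH K * (max 1 (2 * (n : ℝ) / a)) ^ n) / α₂) ^ n * S * w (xs k) := by
  have hC : 0 ≤ (2 * (n : ℝ) ^ 2 * (max SH K * (max 1 (2 * (n : ℝ) / a)) ^ n) / α₂) ^ n := by
    apply pow_nonneg
    apply div_nonneg _ hα.le
    have h1 : 0 ≤ max SH K := hK.trans (le_max_right _ _)
    have h2 : 0 ≤ (max 1 (2 * (n : ℝ) / a)) ^ n := pow_nonneg (zero_le_one.trans (le_max_left _ _)) n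
    positivity
  refine ContinuousMultilinearMap.opNorm_le_bound (by have := hw0 (xs k); positivity) fun b => ?_
  exact norm_kernelE_comp_le_of_loc hU hα hballE hf hS hUW ha hball hH hSH hH0 hK w hw0 hw1 hloc hB xs k b

/-- **With print's weights**: outer sup `S = E₀e^{−κd_j(X)}` ((1.18)) and point weights `w(x) = e^{−δ₀dist^{(ξ)}(X,x)}` (p. 282/286;
`0 ≤ δ₀`, `0 ≤ dist`), for every `k`: `‖𝐄⁽ⁿ⁾(xs)‖ ≤ (2n²B₃/α₂)ⁿ E₀ · exp(−κd_j(X) − δ₀dist^{(ξ)}(X,x_k))` — the printed factors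
«exp(−κd_j(X) − δ₀dist^{(ξ)}(X,x) − …)» of the p. 286 display, here with the farthest point. [cite: Balaban1987RG1, p.286; (1.18) p.263] -/
theorem opNorm_kernelE_comp_le_exp {U : Set E} (hU : IsOpen U) {α₂ E₀ κ djX : ℝ} (hα : 0 < α₂) (hE₀ : 0 ≤ E₀)
    (hballE : ball (0 : E) α₂ ⊆ U) {f : E → F} (hf : AnalyticOnNhd ℂ f U)
    (hS : ∀ y ∈ ball (0 : E) α₂, ‖f y‖ ≤ E₀ * Real.exp (-(κ * djX)))
    {UW : Set (ι → 𝔸)} (hUW : IsOpen UW) {a SH : ℝ} (ha : 0 < a) (hball : ball (0 : ι → 𝔸) a ⊆ UW)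
    {H : (ι → 𝔸) → E} (hH : AnalyticOnNhd ℂ H UW) (hSH : ∀ y ∈ ball (0 : ι → 𝔸) a, ‖H y‖ ≤ SH) (hH0 : H 0 = 0)
    {K δ₀ : ℝ} (hK : 0 ≤ K) (hδ₀ : 0 ≤ δ₀) (dist : ι → ℝ) (hdist : ∀ x, 0 ≤ dist x)
    (hloc : ∀ x, ∀ y ∈ ball (0 : ι → 𝔸) a, ∀ c : 𝔸, ‖fderiv ℂ H y (Pi.single x c)‖ ≤ Real.exp (-(δ₀ * dist x)) * (K * ‖c‖))
    {n : ℕ} (hB : α₂ ≤ 2 * (max SH K * (max 1 (2 * (n : ℝ) / a)) ^ n)) (xs : Fin n → ι) (k : Fin n) :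
    ‖kernelE (𝕜 := ℂ) n (f ∘ H) 0 xs‖ ≤
      (2 * (n : ℝ) ^ 2 * (max SH K * (max 1 (2 * (n : ℝ) / a)) ^ n) / α₂) ^ n * E₀ *
        Real.exp (-(κ * djX) - δ₀ * dist (xs k)) := by
  have h := opNorm_kernelE_comp_le_of_loc hU hα (by positivity) hballE hf hS hUW ha hball hH hSH hH0 hK
    (fun x => Real.exp (-(δ₀ * dist x))) (fun x => (Real.exp_pos _).le)
    (fun x => Real.exp_le_one_iff.mpr (by have := hdist x; nlinarith)) hloc hB xs k
  calc ‖kernelE (𝕜 := ℂ) n (f ∘ H) 0 xs‖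
      ≤ (2 * (n : ℝ) ^ 2 * (max SH K * (max 1 (2 * (n : ℝ) / a)) ^ n) / α₂) ^ n * (E₀ * Real.exp (-(κ * djX))) *
          Real.exp (-(δ₀ * dist (xs k))) := h
    _ = (2 * (n : ℝ) ^ 2 * (max SH K * (max 1 (2 * (n : ℝ) / a)) ^ n) / α₂) ^ n * E₀ *
          Real.exp (-(κ * djX) - δ₀ * dist (xs k)) := by
        rw [sub_eq_add_neg, Real.exp_add]; ring

/-! ## §2. The printed tree-decay shape, under a geometric comparison of the tree lengths -/

/-- **p. 286 «… by a constant times the exponential exp(−O(1)κd_j(X∪{x₁,…,x_n}))»** — r20's typed shape `TreeDecayRemark286Printed`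
for the ACTUAL kernel `xs ↦ 𝐄⁽ⁿ⁾(xs) = kernelE n (f ∘ H) 0 xs` (values in the normed space of `n`-linear maps), with the «constant»
`c := (2n²B₃/α₂)ⁿE₀` and an «O(1)» rate `a′`, GIVEN the geometric comparison `hgeom`: for every tuple some point `x_k` satisfies
`a′κ·d_j(X∪{x₁…x_n}) ≤ κd_j(X) + δ₀dist^{(ξ)}(X,x_k)` (tree length through the cubes of `X` and the points vs. `d_j(X)` plus the distance of
the farthest point — an INPUT, not displayed in print; the cell keeps `d_j` abstract).  Inputs otherwise as §1 ((4.4)/(1.18) outer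
analyticity + sup, Prop. 9 inner analyticity + sup + `𝐇(0) = 0`, (190)-shape first-order point localisation). [cite: Balaban1987RG1, p.286] -/
theorem treeDecayRemark286_of_loc {U : Set E} (hU : IsOpen U) {α₂ E₀ κ djX : ℝ} (hα : 0 < α₂) (hE₀ : 0 ≤ E₀)
    (hballE : ball (0 : E) α₂ ⊆ U) {f : E → F} (hf : AnalyticOnNhd ℂ f U)
    (hS : ∀ y ∈ ball (0 : E) α₂, ‖f y‖ ≤ E₀ * Real.exp (-(κ * djX)))
    {UW : Set (ι → 𝔸)} (hUW : IsOpen UW) {a SH : ℝ} (ha : 0 < a) (hball : ball (0 : ι → 𝔸) a ⊆ UW)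
    {H : (ι → 𝔸) → E} (hH : AnalyticOnNhd ℂ H UW) (hSH : ∀ y ∈ ball (0 : ι → 𝔸) a, ‖H y‖ ≤ SH) (hH0 : H 0 = 0)
    {K δ₀ : ℝ} (hK : 0 ≤ K) (hδ₀ : 0 ≤ δ₀) (dist : ι → ℝ) (hdist : ∀ x, 0 ≤ dist x)
    (hloc : ∀ x, ∀ y ∈ ball (0 : ι → 𝔸) a, ∀ c : 𝔸, ‖fderiv ℂ H y (Pi.single x c)‖ ≤ Real.exp (-(δ₀ * dist x)) * (K * ‖c‖))
    {n : ℕ} (hB : α₂ ≤ 2 * (max SH K * (max 1 (2 * (n : ℝ) / a)) ^ n))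
    (djXpts : (Fin n → ι) → ℝ) {a' : ℝ} (hgeom : ∀ xs : Fin n → ι, ∃ k : Fin n, a' * κ * djXpts xs ≤ κ * djX + δ₀ * dist (xs k)) :
    TreeDecayRemark286Printed (fun xs : Fin n → ι => kernelE (𝕜 := ℂ) n (f ∘ H) 0 xs) djXpts κ
      ((2 * (n : ℝ) ^ 2 * (max SH K * (max 1 (2 * (n : ℝ) / a)) ^ n) / α₂) ^ n * E₀) a' := by
  intro xs
  obtain ⟨k, hk⟩ := hgeom xs
  have h := opNorm_kernelE_comp_le_exp hU hα hE₀ hballE hf hS hUW ha hball hH hSH hH0 hK hδ₀ dist hdist hloc hB xs k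
  have hC : 0 ≤ (2 * (n : ℝ) ^ 2 * (max SH K * (max 1 (2 * (n : ℝ) / a)) ^ n) / α₂) ^ n * E₀ := by
    apply mul_nonneg _ hE₀
    apply pow_nonneg
    apply div_nonneg _ hα.le
    have h1 : 0 ≤ max SH K := hK.trans (le_max_right _ _)
    have h2 : 0 ≤ (max 1 (2 * (n : ℝ) / a)) ^ n := pow_nonneg (zero_le_one.trans (le_max_left _ _)) n
    positivity
  refine h.trans (mul_le_mul_of_nonneg_left (Real.exp_le_exp.mpr ?_) hC)
  linarith

/-! ## §3 (v1.1). The geometric comparison discharged: subadditive tree lengths, explicit rate `a′ = min{1, δ₀/(nκ)}` -/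

/-- [folklore] The sum of `n` reals is at most `n` times a maximal one: for `n ≥ 1` there is an index `k` with
`Σ_i g i ≤ n · g k`. -/
private theorem sum_le_card_mul_max {n : ℕ} (hn : 0 < n) (g : Fin n → ℝ) : ∃ k : Fin n, ∑ i, g i ≤ n * g k := by
  obtain ⟨k, -, hk⟩ := Finset.exists_max_image (Finset.univ : Finset (Fin n)) g ⟨⟨0, hn⟩, Finset.mem_univ _⟩
  refine ⟨k, ?_⟩
  calc ∑ i, g i ≤ ∑ _i : Fin n, g k := Finset.sum_le_sum fun i _ => hk i (Finset.mem_univ _)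
    _ = n * g k := by rw [Finset.sum_const, Finset.card_univ, Fintype.card_fin, nsmul_eq_mul]

/-- **p. 286, "More generally … exp(−O(1)κd_j(X∪{x₁,…,x_n})), where d_j(X∪{x₁,…,x_n}) is a length of a shortest tree graph
connecting cubes □ building the domain X, and points x₁,…,x_n" — for the ACTUAL kernel and EVERY tree length with the concatenation
property.**  A shortest tree graph through the cubes of `X` and the points is at most a shortest tree of `X` prolonged by the `n`
segments from `X` to the points: `d_j(X∪{x₁,…,x_n}) ≤ d_j(X) + Σ_k dist^{(ξ)}(X, x_k)` (hypothesis `hsub` — the only geometry used; the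
tree length `djXpts` and the point distance `dist` stay abstract).  Under the inputs of `treeDecayRemark286_of_loc` ((4.4)/(1.18) for
the outer map with sup `E₀e^{−κd_j(X)}`, [15] Prop. 9 for `𝐇` with `𝐇(0) = 0`, the (190)-shape first-order localisation bound with weight
`e^{−δ₀dist^{(ξ)}(X,x)}` for a field localized at `x`, `α₂ ≤ 2B₃`), for `n ≥ 1` points, `κ > 0`, `d_j(X) ≥ 0`:
`‖𝐄⁽ⁿ⁾(X, x₁,…,x_n)‖ ≤ CₙE₀ · exp(−a′κ·d_j(X∪{x₁,…,x_n}))` with `Cₙ = (2n²B₃/α₂)ⁿ`, `B₃ = max{S_H, K}·max{1, 2n/a}ⁿ` and the explicit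
«O(1)» `a′ = min{1, δ₀/(nκ)}` — r20's `TreeDecayRemark286Printed`, no geometric hypothesis beyond `hsub`.  (*"This bound is enough to
prove bounds of the type (4.22), although with a worse constant"*: the rate degrades by `1/n`, HONEST SCOPE (a).)
[cite: Balaban1987RG1, p.286; (4.3)–(4.5) pp.281–282; (1.18) p.263] -/
theorem treeDecayRemark286_of_subadditive {U : Set E} (hU : IsOpen U) {α₂ E₀ κ djX : ℝ} (hα : 0 < α₂) (hE₀ : 0 ≤ E₀)
    (hballE : ball (0 : E) α₂ ⊆ U) {f : E → F} (hf : AnalyticOnNhd ℂ f U)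
    (hS : ∀ y ∈ ball (0 : E) α₂, ‖f y‖ ≤ E₀ * Real.exp (-(κ * djX)))
    {UW : Set (ι → 𝔸)} (hUW : IsOpen UW) {a SH : ℝ} (ha : 0 < a) (hball : ball (0 : ι → 𝔸) a ⊆ UW)
    {H : (ι → 𝔸) → E} (hH : AnalyticOnNhd ℂ H UW) (hSH : ∀ y ∈ ball (0 : ι → 𝔸) a, ‖H y‖ ≤ SH) (hH0 : H 0 = 0)
    {K δ₀ : ℝ} (hK : 0 ≤ K) (hδ₀ : 0 ≤ δ₀) (dist : ι → ℝ) (hdist : ∀ x, 0 ≤ dist x)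
    (hloc : ∀ x, ∀ y ∈ ball (0 : ι → 𝔸) a, ∀ c : 𝔸, ‖fderiv ℂ H y (Pi.single x c)‖ ≤ Real.exp (-(δ₀ * dist x)) * (K * ‖c‖))
    {n : ℕ} (hn : 0 < n) (hB : α₂ ≤ 2 * (max SH K * (max 1 (2 * (n : ℝ) / a)) ^ n)) (hκ : 0 < κ) (hdjX : 0 ≤ djX)
    (djXpts : (Fin n → ι) → ℝ) (hsub : ∀ xs : Fin n → ι, djXpts xs ≤ djX + ∑ k, dist (xs k)) :
    TreeDecayRemark286Printed (fun xs : Fin n → ι => kernelE (𝕜 := ℂ) n (f ∘ H) 0 xs) djXpts κ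
      ((2 * (n : ℝ) ^ 2 * (max SH K * (max 1 (2 * (n : ℝ) / a)) ^ n) / α₂) ^ n * E₀) (min 1 (δ₀ / (n * κ))) := by
  refine treeDecayRemark286_of_loc hU hα hE₀ hballE hf hS hUW ha hball hH hSH hH0 hK hδ₀ dist hdist hloc hB djXpts ?_
  intro xs
  -- the farthest point of the tuple
  obtain ⟨k, hk⟩ := sum_le_card_mul_max hn fun i => dist (xs i)
  refine ⟨k, ?_⟩
  have hnκ : 0 < (n : ℝ) * κ := mul_pos (by exact_mod_cast hn) hκ
  have ha'0 : 0 ≤ min 1 (δ₀ / (n * κ)) := le_min zero_le_one (div_nonneg hδ₀ hnκ.le)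
  have ha'1 : min 1 (δ₀ / (n * κ)) ≤ 1 := min_le_left _ _
  have ha'2 : min 1 (δ₀ / (n * κ)) * ((n : ℝ) * κ) ≤ δ₀ := by
    rw [← le_div_iff₀ hnκ]
    exact min_le_right _ _
  calc min 1 (δ₀ / (n * κ)) * κ * djXpts xs
      ≤ min 1 (δ₀ / (n * κ)) * κ * (djX + ∑ i, dist (xs i)) :=
        mul_le_mul_of_nonneg_left (hsub xs) (mul_nonneg ha'0 hκ.le)
    _ ≤ min 1 (δ₀ / (n * κ)) * κ * (djX + n * dist (xs k)) :=
        mul_le_mul_of_nonneg_left (by linarith) (mul_nonneg ha'0 hκ.le)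
    _ = min 1 (δ₀ / (n * κ)) * (κ * djX) + min 1 (δ₀ / (n * κ)) * ((n : ℝ) * κ) * dist (xs k) := by ring
    _ ≤ 1 * (κ * djX) + δ₀ * dist (xs k) :=
        add_le_add (mul_le_mul_of_nonneg_right ha'1 (mul_nonneg hκ.le hdjX))
          (mul_le_mul_of_nonneg_right ha'2 (hdist _))
    _ = κ * djX + δ₀ * dist (xs k) := by ring

end Literature.MathematicalPhysics.QuantumFieldTheory.Balaban1983to89.B12KernelDecay286

end
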